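import Summits.BirchSwinnertonDyer.BirchSwinnertonDyer.Theorems.ManinLocalTwoThreeCDivisionCuspGerm
import Literature.NumberTheory.EllipticCurves.ManinConstantGamma1ModularDegree
import Literature.NumberTheory.EllipticCurves.PeriodLatticeGamma1QuotientProofs
import Literature.NumberTheory.EllipticCurves.ModularParametrizationDegreeProofs
import Literature.NumberTheory.EllipticCurves.ModularCurveManinSemistableProofs
import HarnessLib

/-!
# The RATIONAL `q`-series of `℘_{Λ_W}(m·ℰ_f)` near `i∞` (any integer multiplier `m ≠ 0`), and the `X₀(N)`-datum of an
# `X₁(N)`-datum (toward Stevens 1982 Thm 1.3.1 (b); route `ManinLocalTwoThree`, crux C2 stmt-BirchSwinnertonDyer-22967;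
# cell bsd-f2-manin, prover seat p1 gen 22; `--supports stmt-BirchSwinnertonDyer-22967`)

For the Galois action on the cusp values of an `X₁(N)`-parametrisation we need the `q`-expansion at `∞` of its `x`-coordinate
`℘_{Λ_W}(c·ℰ_f) − b₂/12` to be RATIONAL (not integral: Honda's theorem only gives integrality at the multiplier `1`).  This file
proves, for any datum `D` and any integer `m ≠ 0`:

* `exists_modularParametrizationData_of_gamma1` — an `X₁(N)`-datum `D₁` (`cΛ₁(f) ⊆ Λ_W`) yields an `X₀(N)`-datum `D₀` of the same
  curve with the SAME newform, lattice and uniformisation and Manin constant `c·φ(N)` (`φ(N)Λ₀(f) ⊆ Λ₁(f)`,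
  `totient_mul_mem_periodLatticeGamma1`; the degree by `exists_modularDegree_holds`), so that the `X₀`-side germ machinery applies;
* `exists_qGerm_locG_intMul` — the analytic `q`-germ of `(t²x)(u_W(m·ℰ_f))` with RATIONAL Taylor series
  `(X²x)_W(exp_W(m·Σ aₙqⁿ/n))` (multiplier-`m` twin of `CDivCuspGerm.exists_qGerm_locG`);
* `exists_hasSum_qParam_sq_mul_x_intMul` — **`𝕢₁(τ)²·(℘_{Λ_W}(m·ℰ_f(τ)) − b₂/12) = Σ Pₙ 𝕢₁(τ)ⁿ` for `Im τ > B` with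
  `P ∈ ℚ⟦q⟧`** (multiplier-`m` twin of `CDivCuspGerm.exists_hasSum_qParam_sq_mul_x`, rational instead of integral:
  `t = m q + …`, so `x = (t²x)/t²` has the rational series `(X²x)(t)·(t/q)⁻²`).

No definitions, no sorry.  BSD is not proved by this file; C2 is not proved by this file.
[cite: SilvermanAEC2009, IV.1] [cite: Stevens1982, §1.3] [cite: ShimuraIATAF1971, Thm. 7.14]
-/

set_option linter.dupNamespace false
set_option autoImplicit false

noncomputable section

open scoped Topology PeriodPair MatrixGroups
open Complex Filter PowerSeries CongruenceSubgroup
open UpperHalfPlane hiding I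
open WeierstrassCurve Literature.NumberTheory.EllipticCurves Literature.NumberTheory.EllipticCurves.ModularForms
open Summit.BirchSwinnertonDyer.Rank1Residual.ManinAdditive.CuspidalKummer
open Summit.BirchSwinnertonDyer.Rank1Residual.ManinAdditive.CuspidalKummerThree
open Summit.BirchSwinnertonDyer.BirchSwinnertonDyer.Theorems.ManinLocalTwoThree.KummerCubeAnalytic
open Summit.BirchSwinnertonDyer.BirchSwinnertonDyer.Theorems.ManinLocalTwoThree.HalvingParam

namespace Summit.BirchSwinnertonDyer.BirchSwinnertonDyer.Theorems.ManinLocalTwoThree.StevensGalois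

/-! ## §1 The `X₀(N)`-datum of an `X₁(N)`-datum -/

/-- **An `X₁(N)`-datum yields an `X₀(N)`-datum of the same curve**, with the same newform, Néron lattice and uniformisation, and
Manin constant `c·φ(N)` (`φ(N)·Λ₀(f) ⊆ Λ₁(f)`, so `cφ(N)Λ₀(f) ⊆ cΛ₁(f) ⊆ Λ_W`; the degree is supplied by the tree's
`exists_modularDegree_holds`). [cite: Stevens1989, §2] [cite: ShimuraIATAF1971, Thm. 7.14] -/
theorem exists_modularParametrizationData_of_gamma1 {W : WeierstrassCurve ℚ} [W.IsElliptic] {N : ℕ} [NeZero N]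
    (D₁ : Gamma1ParametrizationData W N) (hc : (D₁.c : ℂ) ≠ 0) :
    ∃ D₀ : ModularParametrizationData W N, D₀.f = D₁.f ∧ D₀.L = D₁.L ∧ D₀.uniformize = D₁.uniformize ∧
      D₀.c = D₁.c * (Nat.totient N : ℤ) := by
  have hφ0 : (Nat.totient N : ℤ) ≠ 0 := by exact_mod_cast (Nat.totient_pos.mpr (NeZero.pos N)).ne'
  have hk0 : D₁.c * (Nat.totient N : ℤ) ≠ 0 := mul_ne_zero (by exact_mod_cast hc) hφ0
  have hk : ∀ z ∈ periodLattice D₁.f, ((D₁.c * (Nat.totient N : ℤ) : ℤ) : ℂ) * z ∈ D₁.L.lattice := by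
    intro z hz
    have h1 := totient_mul_mem_periodLatticeGamma1 D₁.f hz
    have h2 := D₁.smul_periodLatticeGamma1_le _ h1
    push_cast
    rw [mul_assoc]
    exact h2
  obtain ⟨d, hd, hfin⟩ := exists_modularDegree_holds D₁.isNewformOf.1.ne_zero (L := D₁.L)
    (c := ((D₁.c * (Nat.totient N : ℤ) : ℤ) : ℂ)) (Int.cast_ne_zero.mpr hk0) hk
  have hker' : D₁.L.lattice.toAddSubgroup = D₁.uniformize.ker :=
    SetLike.coe_injective (by rw [Submodule.coe_toAddSubgroup, D₁.ker_uniformize])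
  let e : ℂ ⧸ D₁.L.lattice.toAddSubgroup ≃+ (W.baseChange ℂ).toAffine.Point :=
    QuotientAddGroup.liftEquiv D₁.L.lattice.toAddSubgroup D₁.uniformize_surjective hker'
  have he : ∀ x : ℂ, e.toEquiv (x : ℂ ⧸ D₁.L.lattice.toAddSubgroup) = D₁.uniformize x := fun _ ↦ rfl
  have key := (finite_setOf_card_fiberOrbits_ne_iff e.toEquiv
    (fun τ : ℍ ↦ ((((D₁.c * (Nat.totient N : ℤ) : ℤ) : ℂ) * eichlerIntegral D₁.f τ : ℂ) : ℂ ⧸ D₁.L.lattice.toAddSubgroup))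
    d).mpr hfin
  simp only [he] at key
  exact ⟨{ f := D₁.f
           isNewformOf := D₁.isNewformOf
           L := D₁.L
           isNeronLattice := D₁.isNeronLattice
           uniformize := D₁.uniformize
           ker_uniformize := D₁.ker_uniformize
           uniformize_surjective := D₁.uniformize_surjective
           uniformize_spec := D₁.uniformize_spec
           c := D₁.c * (Nat.totient N : ℤ)
           smul_periodLattice_le := hk
           deg := d
           deg_pos := hd
           deg_spec := key }, rfl, rfl, rfl, rfl⟩

/-! ## §2 The germ `(t²x)∘(m·ε)` -/

/-- **`G = (t_W²·x_W)∘(m·ε)` is an analytic `q`-germ** with `G(0) = 1`, RATIONAL Taylor series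
`(X²x)_W(exp_W(m·Σ aₙqⁿ/n))` and `G(𝕢₁τ) = locG(m·ℰ_f τ)` (multiplier-`m` twin of `CDivCuspGerm.exists_qGerm_locG`).
[cite: SilvermanAEC2009, IV.1] -/
theorem exists_qGerm_locG_intMul (W : WeierstrassCurve ℚ) [W.IsElliptic] {N : ℕ} [NeZero N]
    (D : ModularParametrizationData W N) (a : ℕ → ℤ) (ha : ∀ n, (a n : ℂ) = cuspCoeff D.f n) (m : ℤ) :
    ∃ G : ℂ → ℂ, AnalyticAt ℂ G 0 ∧ G 0 = 1 ∧
      taylorAt0 G = PowerSeries.map (algebraMap ℚ ℂ)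
        (W.formalXMulSq.subst (W.formalExp.subst ((m : ℚ) • lSeriesLog a)) : ℚ⟦X⟧) ∧
      ∀ τ : ℍ, G (Function.Periodic.qParam 1 (τ : ℂ)) = locG D.L (W.baseChange ℂ) ((m : ℂ) * eichlerIntegral D.f τ) := by
  set V := W.baseChange ℂ with hV
  obtain ⟨h₂, h₃⟩ := D.isNeronLattice
  rw [← hV] at h₂ h₃
  set ε : ℂ → ℂ := fun q ↦ (m : ℂ) * qGerm D.f q with hεdef
  have hε : AnalyticAt ℂ ε 0 := analyticAt_const.mul (analyticAt_qGerm D.f)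
  have hε0 : ε 0 = 0 := by simp [hεdef, qGerm_zero]
  have hga : AnalyticAt ℂ (locG D.L V) 0 := analyticAt_locG D.L V
  refine ⟨locG D.L V ∘ ε, ?_, ?_, ?_, ?_⟩
  · have h' : AnalyticAt ℂ (locG D.L V) (ε 0) := by rw [hε0]; exact hga
    exact h'.comp hε
  · rw [Function.comp_apply, hε0, locG, if_pos (zero_mem _)]
  · have hTε : taylorAt0 ε = C (m : ℂ) * taylorAt0 (qGerm D.f) := by
      rw [hεdef]
      exact Literature.NumberTheory.Transcendental.AndreCriterion.taylor_const_mul (m : ℂ) (qGerm D.f)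
    have hcL0 : constantCoeff ((m : ℚ) • lSeriesLog a) = 0 := by
      rw [← coeff_zero_eq_constantCoeff_apply, coeff_smul, coeff_zero_eq_constantCoeff_apply, lSeriesLog,
        ← coeff_zero_eq_constantCoeff_apply, coeff_mk]
      simp
    have hsL : HasSubst ((m : ℚ) • lSeriesLog a) := HasSubst.of_constantCoeff_zero' hcL0
    have hE0 : constantCoeff (W.formalExp.subst ((m : ℚ) • lSeriesLog a)) = 0 :=
      PowerSeries.constantCoeff_subst_eq_zero hcL0 _ W.constantCoeff_formalExp
    have hsE : HasSubst (W.formalExp.subst ((m : ℚ) • lSeriesLog a)) := HasSubst.of_constantCoeff_zero' hE0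
    have hsEV : HasSubst V.formalExp := HasSubst.of_constantCoeff_zero' V.constantCoeff_formalExp
    have hmapL : ((m : ℚ) • lSeriesLog a).map (algebraMap ℚ ℂ) = taylorAt0 ε := by
      rw [hTε, taylorAt0_qGerm]
      ext n
      rw [coeff_map, coeff_smul, coeff_C_mul, lSeriesLog, coeff_mk, coeff_mk, ← ha n, smul_eq_mul]
      simp
    have hT0 : constantCoeff (taylorAt0 ε) = 0 := by rw [constantCoeff_taylorAt0, hε0]
    have hsT : HasSubst (taylorAt0 ε) := HasSubst.of_constantCoeff_zero' hT0
    rw [taylorAt0_comp hga hε hε0, taylorAt0_locG D.L V h₂ h₃, PowerSeries.subst_comp_subst_apply hsEV hsT,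
      map_subst_univ hsE, map_subst_univ hsL, hmapL, hV, WeierstrassCurve.baseChange, WeierstrassCurve.map_formalExp,
      WeierstrassCurve.map_formalXMulSq]
  · intro τ
    simp [hεdef, qGerm_apply]

/-! ## §3 The rational `q`-series of `𝕢²·(℘_{Λ_W}(m·ℰ_f) − b₂/12)` -/

/-- `m·ε(q) ∉ Λ` for `q ≠ 0` small (`ε(q) ∉ m⁻¹Λ`, a lattice). [folklore] -/
private theorem eventually_intMul_qGerm_notMem {M : ℕ} [NeZero M] (f : CuspForm (Gamma0 M) 2) (hf1 : cuspCoeff f 1 = 1)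
    (L : PeriodPair) {m : ℤ} (hm : m ≠ 0) :
    ∀ᶠ q in 𝓝[≠] (0 : ℂ), (m : ℂ) * qGerm f q ∉ L.lattice := by
  have hm' : ((m : ℂ))⁻¹ ≠ 0 := inv_ne_zero (Int.cast_ne_zero.mpr hm)
  filter_upwards [eventually_qGerm_notMem f hf1 (L.mulLeft ((m : ℂ)⁻¹) hm')] with q hq
  intro h
  apply hq
  rw [PeriodPair.mem_mulLeft_lattice, inv_inv]
  exact h

/-- **The rational `q`-series of the `x`-coordinate at the multiplier `m`**: for a datum `D` and an integer `m ≠ 0` there are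
`P ∈ ℚ⟦X⟧` and `B` with `Σₙ Pₙ 𝕢₁(τ)ⁿ = 𝕢₁(τ)²·(℘_{Λ_W}(m·ℰ_f(τ)) − b₂/12)` for `Im τ > B`.  (Multiplier-`m` twin of
`CDivCuspGerm.exists_hasSum_qParam_sq_mul_x`; rational, not integral.) [cite: SilvermanAEC2009, IV.1] [cite: ShimuraIATAF1971, Thm. 7.14] -/
theorem exists_hasSum_qParam_sq_mul_x_intMul (W : WeierstrassCurve ℚ) [W.IsElliptic] {N : ℕ} [NeZero N]
    (D : ModularParametrizationData W N) {m : ℤ} (hm : m ≠ 0) :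
    ∃ (P : ℚ⟦X⟧) (B : ℝ), ∀ τ : ℍ, B < τ.im →
      HasSum (fun n : ℕ ↦ ((coeff n P : ℚ) : ℂ) * Function.Periodic.qParam 1 (τ : ℂ) ^ n)
        (Function.Periodic.qParam 1 (τ : ℂ) ^ 2 * (℘[D.L] ((m : ℂ) * eichlerIntegral D.f τ) - (W.b₂ : ℂ) / 12)) := by
  classical
  set V := W.baseChange ℂ with hV
  set a : ℕ → ℤ := fun n ↦ W.LFunction n with hadef
  have ha : ∀ n, (a n : ℂ) = cuspCoeff D.f n := fun n ↦ by rw [D.isNewformOf.2 n]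
  have hf1 : cuspCoeff D.f 1 = 1 := D.isNewformOf.1.2.2
  have ha1 : a 1 = 1 := by
    have h := ha 1
    rw [hf1] at h
    exact_mod_cast h
  -- the two germs
  obtain ⟨G, hGan, hG0, hTG, hGval⟩ := exists_qGerm_locG_intMul W D a ha m
  obtain ⟨Z, hZan, hZ0, hTZ, hZval⟩ := exists_qGerm_locT_intMul W D a ha m
  -- the rational Taylor series of `Z` and its shift `U`
  set TZ : ℚ⟦X⟧ := W.formalExp.subst ((m : ℚ) • lSeriesLog a) with hTZdef
  have hcL0 : constantCoeff ((m : ℚ) • lSeriesLog a) = 0 := by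
    rw [← coeff_zero_eq_constantCoeff_apply, coeff_smul, coeff_zero_eq_constantCoeff_apply, lSeriesLog,
      ← coeff_zero_eq_constantCoeff_apply, coeff_mk]
    simp
  have hTZ0 : constantCoeff TZ = 0 := PowerSeries.constantCoeff_subst_eq_zero hcL0 _ W.constantCoeff_formalExp
  have hE1 : coeff 1 W.formalExp = 1 := by
    have h := congrArg (coeff 1) W.formalLog_subst_formalExp
    rwa [coeff_one_subst_eq_mul _ W.constantCoeff_formalExp, coeff_one_formalLog, one_mul, coeff_one_X] at h
  have hTZ1 : coeff 1 TZ = m := by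
    rw [hTZdef, coeff_one_subst_eq_mul _ hcL0, hE1, one_mul, coeff_smul, lSeriesLog, coeff_mk, ha1]
    simp
  set U : ℚ⟦X⟧ := PowerSeries.mk fun p ↦ coeff (p + 1) TZ with hU
  have hZU : TZ = X * U := by
    have h := PowerSeries.eq_X_mul_shift_add_const TZ
    rw [hTZ0, map_zero, add_zero] at h
    exact h
  have hU0 : constantCoeff U = m := by
    rw [← coeff_zero_eq_constantCoeff_apply, hU, coeff_mk, zero_add, hTZ1]
  have hU0' : constantCoeff U ≠ 0 := by rw [hU0]; exact_mod_cast hm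
  -- `Z = q·Uf`, `Uf := dslope Z 0` analytic with `Uf 0 = m`
  set Uf : ℂ → ℂ := dslope Z 0 with hUf
  have hZq : ∀ q, Z q = q * Uf q := fun q ↦ by
    have h := sub_smul_dslope Z 0 q
    rw [sub_zero, hZ0, sub_zero, smul_eq_mul] at h
    exact h.symm
  have hUfan : AnalyticAt ℂ Uf 0 := by
    obtain ⟨p, hp⟩ := hZan
    exact ⟨_, hp.has_fpower_series_dslope_fslope⟩
  have hTUmap : taylorAt0 Uf = U.map (algebraMap ℚ ℂ) := by
    have h1 : taylorAt0 Z = X * taylorAt0 Uf := by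
      have hfun : Z = (fun q : ℂ ↦ q) * Uf := by funext q; rw [Pi.mul_apply]; exact hZq q
      have hid : AnalyticAt ℂ (fun q : ℂ ↦ q) 0 := analyticAt_id
      have h := congrArg taylorAt0 hfun
      simp only [taylorAt0] at h ⊢
      rw [Literature.NumberTheory.Transcendental.AndreCriterion.taylor_mul hid hUfan] at h
      rw [h]
      congr 1
      exact taylorAt0_id
    have h2 : taylorAt0 Z = X * U.map (algebraMap ℚ ℂ) := by
      rw [hTZ, hZU, map_mul, map_X]
    exact mul_left_cancel₀ X_ne_zero (h1.symm.trans h2)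
  have hUf0 : Uf 0 = m := by
    have h := constantCoeff_taylorAt0 Uf
    rw [hTUmap, ← coeff_zero_eq_constantCoeff_apply, coeff_map, coeff_zero_eq_constantCoeff_apply, hU0] at h
    simpa using h.symm
  have hUf0' : Uf 0 ≠ 0 := by rw [hUf0]; exact_mod_cast hm
  -- the germ `Xq := G/Uf²` and its rational Taylor series `P := (X²x)(TZ)·U⁻²`
  set Xq : ℂ → ℂ := fun q ↦ G q / Uf q ^ 2 with hXq
  have hXqan : AnalyticAt ℂ Xq 0 := hGan.div (hUfan.pow 2) (pow_ne_zero 2 hUf0')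
  set P : ℚ⟦X⟧ := W.formalXMulSq.subst TZ * U⁻¹ ^ 2 with hPdef
  have hPU : P * U ^ 2 = W.formalXMulSq.subst TZ := by
    rw [hPdef, mul_assoc, ← mul_pow, PowerSeries.inv_mul_cancel _ hU0', one_pow, mul_one]
  have hTXq : taylorAt0 Xq = P.map (algebraMap ℚ ℂ) := by
    have hprod : taylorAt0 Xq * taylorAt0 Uf ^ 2 = taylorAt0 G := by
      have hUfne : ∀ᶠ q in 𝓝 (0 : ℂ), Uf q ≠ 0 := hUfan.continuousAt.eventually_ne hUf0'
      have hfun : G =ᶠ[𝓝 0] Xq * Uf ^ 2 := by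
        filter_upwards [hUfne] with q hq
        rw [Pi.mul_apply, Pi.pow_apply, hXq]
        field_simp
      have h := Literature.NumberTheory.Transcendental.AndreCriterion.taylor_congr hfun
      simp only [taylorAt0] at h ⊢
      rw [Literature.NumberTheory.Transcendental.AndreCriterion.taylor_mul hXqan (hUfan.pow 2),
        Literature.NumberTheory.Transcendental.AndreCriterion.taylor_pow hUfan 2] at h
      exact h.symm
    rw [hTUmap, hTG, ← hPU, map_mul, map_pow] at hprod
    have hUne : (U.map (algebraMap ℚ ℂ)) ^ 2 ≠ 0 := by
      refine pow_ne_zero 2 fun h0 ↦ ?_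
      have h := congrArg constantCoeff h0
      rw [← coeff_zero_eq_constantCoeff_apply, coeff_map, coeff_zero_eq_constantCoeff_apply, hU0, map_zero] at h
      have : (m : ℂ) = 0 := by simpa using h
      exact hm (by exact_mod_cast this)
    exact mul_right_cancel₀ hUne hprod
  -- near `q = 0`
  obtain ⟨r, hr, hsum⟩ := exists_hasSum_taylorAt0 hXqan
  have hUfne' : ∀ᶠ q in 𝓝 (0 : ℂ), Uf q ≠ 0 := hUfan.continuousAt.eventually_ne hUf0'
  have hev : ∀ᶠ q in 𝓝[≠] (0 : ℂ), HasSum (fun n : ℕ ↦ coeff n (taylorAt0 Xq) * q ^ n) (Xq q) ∧ Uf q ≠ 0 ∧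
      (m : ℂ) * qGerm D.f q ∉ D.L.lattice := by
    have h1 : ∀ᶠ q in 𝓝 (0 : ℂ), ‖q‖ < r := by
      have : Metric.ball (0 : ℂ) r ∈ 𝓝 (0 : ℂ) := Metric.ball_mem_nhds 0 hr
      filter_upwards [this] with q hq
      rwa [Metric.mem_ball, dist_zero_right] at hq
    filter_upwards [(h1.and hUfne').filter_mono nhdsWithin_le_nhds, eventually_intMul_qGerm_notMem D.f hf1 D.L hm] with q hq hqΛ
    exact ⟨hsum q hq.1, hq.2, hqΛ⟩
  obtain ⟨B, hB⟩ := exists_im_bound_of_eventually hev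
  refine ⟨P, B, fun τ hτ ↦ ?_⟩
  obtain ⟨hS, hUq, hΛ⟩ := hB τ hτ
  set q := Function.Periodic.qParam 1 (τ : ℂ) with hq
  have hEq : qGerm D.f q = eichlerIntegral D.f τ := qGerm_apply D.f τ
  rw [hEq] at hΛ
  have hZval' : Z q = locT D.L V ((m : ℂ) * eichlerIntegral D.f τ) := by simpa [hq] using hZval τ
  have hval : Xq q = q ^ 2 * (℘[D.L] ((m : ℂ) * eichlerIntegral D.f τ) - (W.b₂ : ℂ) / 12) := by
    have hG := hGval τ
    rw [← hq, locG, if_neg hΛ, ← hZval'] at hG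
    have hb₂ : V.b₂ = (W.b₂ : ℂ) := by rw [hV, WeierstrassCurve.baseChange, WeierstrassCurve.map_b₂]; rfl
    have hUq' : Uf q ≠ 0 := hUq
    rw [hXq]
    simp only
    rw [hG, hZq q, hb₂]
    field_simp
  rw [← hval]
  rw [hTXq] at hS
  convert hS using 2 with n
  rw [coeff_map]
  simp

end Summit.BirchSwinnertonDyer.BirchSwinnertonDyer.Theorems.ManinLocalTwoThree.StevensGalois

end
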